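import Literature.NumberTheory.DiophantineGeometry.PlaneCurvePlacesAtPointsProofs
import Literature.NumberTheory.DiophantineGeometry.FunctionFieldRationalPlaceBoundsProofs
import Literature.NumberTheory.DiophantineGeometry.PlaneCurvePartialDerivativesProofs
import Literature.NumberTheory.DiophantineGeometry.PlaneCurveRationalPointProofs
import Literature.NumberTheory.DiophantineGeometry.PlaneCurveBezoutWeak
import Literature.NumberTheory.DiophantineGeometry.PlaneCurvePointCountProofs
import HarnessLib

/-!
# The number of rational points of an absolutely irreducible affine plane curve
(Weil's estimate for possibly singular curves)

For a finite field `K = 𝔽_q` and `Φ ∈ K[X][Y]` monic of degree `d` in `Y`, of total degree `d`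
(`deg_X (coeff of Yⁱ) + i ≤ d` for `i < d`) and absolutely irreducible, the number `N` of zeros of
`Φ` in `K²` satisfies

  `q + 1 - (d-1)(d-2)√q - d - 4d³ ≤ N ≤ q + 1 + (d-1)(d-2)√q + 4d³`

(`card_zeros_bounds_of_irreducible_map`), i.e. Weil's estimate
`|N - q| ≤ (d-1)(d-2)√q + O(d³)` for a possibly singular affine plane curve — the form (with the
lower-order term `δ + 1 + δ²` replaced by `1 + δ + 4δ³`, which is all the same for its use) of
eq. (1) and Lemma 5.1 (`ν = 1`) of A. Cafure, G. Matera, *Improved explicit estimates on the number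
of solutions of equations over a finite field*, Finite Fields Appl. 12 (2006), there quoted from
Weil 1948 / Schmidt 1974 (and proved for singular curves by Aubry–Perret 1996 and Leep–Yeomans
1994).

## Proof

Let `F = K(X)[Y]/(Φ)`, an algebraic function field with full constant field `K` (absolute
irreducibility, `PlaneCurveConstantFieldProofs`) and genus `g`, `2g ≤ (d-1)(d-2)`
(`PlaneCurveGenusBoundProofs`). By Hasse–Weil, the number `N₁` of rational places satisfies
`|N₁ - (q+1)| ≤ 2g√q` (`FunctionFieldRationalPlaceBoundsProofs`). At most `d` rational places are
poles of `x` (`deg (x)_∞ = d`); the others are *finite* and have a centre `(x̄(P), ȳ(P)) ∈ K²`, a zero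
of `Φ`. Over a nonsingular zero (one partial derivative nonzero) there is exactly one place, and it
is rational (`PlaneCurvePlacesAtPointsProofs`); over the zeros with first coordinate `a` there are at
most `d` rational places (`deg (x - a)_0 = d`), and there are at most `d` such zeros. The first
coordinates of the singular zeros are roots of the eliminant of `Φ` and a nonzero partial derivative
(`PlaneCurvePartialDerivativesProofs`, `PlaneCurveBezoutWeak.exists_eliminant`), a nonzero
polynomial of degree `≤ 4d²`. Hence `|N - N₁^{fin}| ≤ d · 4d²`, and the estimate follows.

Compared with the sibling `PlaneCurvePointCountProofs` (fibrewise, through Kummer's theorem, for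
plane models SEPARABLE over `K(X)`, with the sharper lower-order term `d(1 + d(d-1))`), this file
needs no separability hypothesis (inseparable models such as `Y^p - X` are allowed: the place above
a nonsingular point is produced by localisation, `PlaneCurvePlacesAtPointsProofs`, using whichever
partial derivative is nonzero), at the price of the cruder term `4d³`.

## References

* A. Cafure, G. Matera, Finite Fields Appl. 12 (2006) 155–185, §1 eq. (1), Lemma 5.1.
  [CafureMatera2006]
* H. Stichtenoth, *Algebraic Function Fields and Codes*, 2nd ed., GTM 254, Springer 2009,
  Thm. 5.2.3. [Stichtenoth2009]
* W. Fulton, *Algebraic Curves*, 3rd ed. 2008, §3.1–3.2. [Fulton2008]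
-/

noncomputable section

open scoped Classical Polynomial.Bivariate IntermediateField
open Polynomial

namespace Literature.NumberTheory.DiophantineGeometry.AlgFunctionField

universe u v

variable {K : Type u} {F : Type v} [Field K] [Field F] [Algebra K F]

/-! ### Residues at a rational place -/

namespace PlaceOver

/-- At a place `P`, the residue of `z ∈ 𝒪_P` is the constant `a` iff `v_P(z - a) > 0`. [folklore] -/
theorem residue_eq_algebraMap_iff (P : PlaceOver K F) {z : F} (hz : z ∈ P.toValuationSubring)
    (a : K) : IsLocalRing.residue P.toValuationSubring ⟨z, hz⟩ = algebraMap K P.residueField a ↔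
      P.valuation (z - algebraMap K F a) < 1 := by
  rw [PlaceOver.algebraMap_residueField_apply, ← sub_eq_zero, ← map_sub,
    IsLocalRing.residue_eq_zero_iff, ValuationSubring.valuation_lt_one_iff]
  rfl

/-- At a rational place the residue of `z ∈ 𝒪_P` is (the image of) a unique constant `z̄(P) ∈ K`.
[cite: Stichtenoth2009, Def. 1.1.14] -/
theorem existsUnique_residue_eq (P : PlaceOver K F) (hP : P.degree = 1) {z : F}
    (hz : z ∈ P.toValuationSubring) :
    ∃! a : K, IsLocalRing.residue P.toValuationSubring ⟨z, hz⟩ = algebraMap K P.residueField a := by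
  obtain ⟨a, ha⟩ := P.algebraMap_residueField_surjective_of_degree_eq_one hP
    (IsLocalRing.residue P.toValuationSubring ⟨z, hz⟩)
  exact ⟨a, ha.symm, fun b hb ↦ (algebraMap K P.residueField).injective (hb.symm.trans ha.symm)⟩

/-- **The centre of a rational place is a rational point** (with specified residues): if
`x ≡ a`, `y ≡ b (mod P)` and `Φ(x, y) = 0` then `Φ(a, b) = 0`. [folklore] -/
theorem evalEval_eq_zero_of_residue_eq (P : PlaceOver K F) {x y : F}
    (hx : x ∈ P.toValuationSubring) (hy : y ∈ P.toValuationSubring) {a b : K}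
    (ha : IsLocalRing.residue P.toValuationSubring ⟨x, hx⟩ = algebraMap K P.residueField a)
    (hb : IsLocalRing.residue P.toValuationSubring ⟨y, hy⟩ = algebraMap K P.residueField b)
    {Φ : K[X][Y]} (hΦ : (Φ.map (mapRingHom (algebraMap K F))).evalEval x y = 0) :
    Φ.evalEval a b = 0 := by
  set O := P.toValuationSubring with hO
  have hO0 : (Φ.map (mapRingHom (algebraMap K O))).evalEval ⟨x, hx⟩ ⟨y, hy⟩ = 0 := by
    have hinj : Function.Injective (algebraMap O F) := fun u v h ↦ Subtype.ext h
    apply hinj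
    rw [map_evalEval_map_mapRingHom, map_zero, ← IsScalarTower.algebraMap_eq K O F]
    exact hΦ
  have hres := congrArg (IsLocalRing.residue O) hO0
  rw [map_evalEval_map_mapRingHom, map_zero] at hres
  have hcomp : (IsLocalRing.residue O).comp (algebraMap K O) = algebraMap K P.residueField :=
    RingHom.ext fun c ↦ (P.algebraMap_residueField_apply c).symm
  rw [hcomp, ha, hb, map_mapRingHom_evalEval] at hres
  exact (algebraMap K P.residueField).injective (by rw [hres, map_zero])

end PlaceOver

/-! ### Counting lemmas in `K[X][Y]` -/

-- For `Φ` monic of degree `d` in `Y` and `a ∈ K`, at most `d` elements `b ∈ K` satisfy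
-- `Φ(a, b) = 0`: this is `card_filter_evalEval_le` (`PlaneCurveSeparableFibersProofs`).

/-- Coefficient degree bounds for a plane model: if `Φ` is monic of degree `d` in `Y` with
`deg_X (coeff of Yⁱ) + i ≤ d` for `i < d`, then every coefficient has `X`-degree `≤ d`. [folklore] -/
theorem natDegree_coeff_le_of_monic {Φ : K[X][Y]} (hm : Φ.Monic)
    (hdeg : ∀ i, i < Φ.natDegree → (Φ.coeff i).natDegree + i ≤ Φ.natDegree) (i : ℕ) :
    (Φ.coeff i).natDegree ≤ Φ.natDegree := by
  rcases lt_trichotomy i Φ.natDegree with h | h | h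
  · have := hdeg i h; omega
  · rw [h, ← Polynomial.leadingCoeff, hm.leadingCoeff, natDegree_one]; exact Nat.zero_le _
  · rw [coeff_eq_zero_of_natDegree_lt h, natDegree_zero]; exact Nat.zero_le _

/-- **The `x`-coordinates of the singular zeros of an irreducible `Φ` over a finite field lie among
the roots of a nonzero polynomial of degree `≤ 4d²`** (the eliminant of `Φ` and a nonzero partial
derivative). [cite: Fulton2008, §3.1] -/
theorem exists_eliminant_singular [Finite K] {Φ : K[X][Y]} (hm : Φ.Monic) (hirr : Irreducible Φ)
    (hdeg : ∀ i, i < Φ.natDegree → (Φ.coeff i).natDegree + i ≤ Φ.natDegree) :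
    ∃ R : K[X], R ≠ 0 ∧ R.natDegree ≤ 4 * Φ.natDegree ^ 2 ∧
      ∀ a b : K, Φ.evalEval a b = 0 → (derivative Φ).evalEval a b = 0 →
        (derivative (Bivariate.swap Φ)).evalEval b a = 0 → R.eval a = 0 := by
  set d := Φ.natDegree with hd
  have hcoef : ∀ i, (Φ.coeff i).natDegree ≤ d := natDegree_coeff_le_of_monic hm hdeg
  have h4 : (d + d) * (d + d) = 4 * d ^ 2 := by ring
  rcases derivative_ne_zero_or_of_irreducible hirr with h0 | h0
  · -- eliminate with `∂Φ/∂Y`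
    have hGd : (derivative Φ).natDegree ≤ d := (natDegree_derivative_le Φ).trans (Nat.sub_le _ _)
    have hGc : ∀ i, ((derivative Φ).coeff i).natDegree ≤ d := fun i ↦ by
      rw [coeff_derivative]
      calc (Φ.coeff (i + 1) * ((i : K[X]) + 1)).natDegree
          ≤ (Φ.coeff (i + 1)).natDegree + ((i : K[X]) + 1).natDegree := natDegree_mul_le
        _ ≤ d := by rw [← Nat.cast_succ, natDegree_natCast, add_zero]; exact hcoef _
    obtain ⟨R, hR0, hRd, hR⟩ := Dioph.exists_eliminant hirr (not_dvd_derivative_of_ne_zero h0)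
      le_rfl hcoef hGd hGc
    exact ⟨R, hR0, h4 ▸ hRd, fun a b hab hY _ ↦ hR a b hab hY⟩
  · -- eliminate with `∂Φ/∂X`
    have hGd : (Bivariate.swap (derivative (Bivariate.swap Φ))).natDegree ≤ d :=
      natDegree_swap_derivative_swap_le Φ
    have hGc : ∀ i, ((Bivariate.swap (derivative (Bivariate.swap Φ))).coeff i).natDegree ≤ d :=
      fun i ↦ (natDegree_coeff_swap_derivative_swap_le Φ i).trans (hcoef i)
    obtain ⟨R, hR0, hRd, hR⟩ := Dioph.exists_eliminant hirr
      (not_dvd_swap_derivative_swap_of_ne_zero hm h0) le_rfl hcoef hGd hGc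
    refine ⟨R, hR0, h4 ▸ hRd, fun a b hab _ hX ↦ hR a b hab ?_⟩
    rw [evalEval_swap_eq]
    exact hX


/-! ### The two-sided estimate -/

/-- **Weil's estimate for a possibly singular affine plane curve (two-sided, explicit lower-order
term).** Let `K = 𝔽_q` and let `Φ ∈ K[X][Y]` be monic of degree `d` in `Y`, with
`deg_X (coeff of Yⁱ) + i ≤ d` for `i < d` (total degree `d`), and absolutely irreducible (irreducible
image in `K̄[X][Y]` for an embedding `σ` of `K` into an algebraically closed field). Then the number
`N` of zeros of `Φ` in `K²` satisfies
`q + 1 - (d-1)(d-2)√q - d - 4d³ ≤ N ≤ q + 1 + (d-1)(d-2)√q + 4d³`.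
This is the estimate `|N - q| ≤ (δ-1)(δ-2)q^{1/2} + δ + 1 + (lower order)` of Cafure–Matera's
eq. (1) / Lemma 5.1 (case `ν = 1`), with the printed lower-order term `δ²` replaced by `4δ³`
(from the weak eliminant bound used to control the singular points).
[cite: CafureMatera2006, §1 eq. (1) and Lemma 5.1] [cite: Stichtenoth2009, Thm. 5.2.3] -/
theorem card_zeros_bounds_of_irreducible_map [Fintype K] {Φ : K[X][Y]} (hm : Φ.Monic)
    (hdeg : ∀ i, i < Φ.natDegree → (Φ.coeff i).natDegree + i ≤ Φ.natDegree)
    {Kbar : Type*} [Field Kbar] [IsAlgClosed Kbar] (σ : K →+* Kbar)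
    (hirr : Irreducible (Φ.map (mapRingHom σ))) :
    ((((Finset.univ : Finset (K × K)).filter fun z ↦ Φ.evalEval z.1 z.2 = 0).card : ℝ) ≤
        (Fintype.card K : ℝ) + 1 +
          ((Φ.natDegree - 1) * (Φ.natDegree - 2) : ℕ) * √(Fintype.card K : ℝ) +
            4 * (Φ.natDegree : ℝ) ^ 3) ∧
      ((Fintype.card K : ℝ) + 1 -
          ((Φ.natDegree - 1) * (Φ.natDegree - 2) : ℕ) * √(Fintype.card K : ℝ) -
            Φ.natDegree - 4 * (Φ.natDegree : ℝ) ^ 3 ≤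
        (((Finset.univ : Finset (K × K)).filter fun z ↦ Φ.evalEval z.1 z.2 = 0).card : ℝ)) := by
  -- ### the function field `L = K(X)[Y]/(Φ)`
  have hirrK : Irreducible Φ := irreducible_of_irreducible_map σ hm hirr
  set ΦL : (RatFunc K)[X] := Φ.map (algebraMap K[X] (RatFunc K)) with hΦL
  have hmL : ΦL.Monic := hm.map _
  have hirrL : Irreducible ΦL := irreducible_map_ratFunc hm hirrK
  haveI : Fact (Irreducible ΦL) := ⟨hirrL⟩
  set pb := AdjoinRoot.powerBasis hirrL.ne_zero with hpb
  have hgen : pb.gen = AdjoinRoot.root ΦL := AdjoinRoot.powerBasis_gen _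
  have hmin : minpoly (RatFunc K) pb.gen = ΦL := AdjoinRoot.minpoly_powerBasis_gen_of_monic hmL
  have hdim : pb.dim = Φ.natDegree := by
    rw [← pb.natDegree_minpoly, hmin, hm.natDegree_map]
  haveI : IsAlgFunctionField K (AdjoinRoot ΦL) := isAlgFunctionField_of_powerBasis pb
  haveI : IsIntegrallyClosedIn K (AdjoinRoot ΦL) :=
    isIntegrallyClosedIn_of_irreducible_map pb hm hmin σ hirr
  set x : AdjoinRoot ΦL := algebraMap K[X] (AdjoinRoot ΦL) X with hx
  have hxt : Transcendental K x := transcendental_algebraMap_X K (AdjoinRoot ΦL)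
  have hx0 : x ≠ 0 := algebraMap_X_ne_zero K (AdjoinRoot ΦL)
  have hΦy : aeval pb.gen ΦL = 0 := by
    rw [hgen, AdjoinRoot.aeval_eq, AdjoinRoot.mk_self]
  have hy : pb.gen ∈ riemannRochSpace (principalDivisor K x)⁻ :=
    mem_riemannRochSpace_negPart_of_aeval_eq_zero' hΦy hm hdeg
  have hΦxy : (Φ.map (mapRingHom (algebraMap K (AdjoinRoot ΦL)))).evalEval x pb.gen = 0 :=
    evalEval_algebraMap_X_eq_zero hΦy
  have hfin : Module.finrank K⟮x⟯ (AdjoinRoot ΦL) = pb.dim := finrank_adjoin_algebraMap_X_eq_dim pb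
  have hgenus : 2 * genus K (AdjoinRoot ΦL) ≤ (pb.dim - 1) * (pb.dim - 2) :=
    two_mul_genus_le_of_planeModel hxt hfin hy (linearIndependent_monomial pb)
  rw [hdim] at hfin hgenus
  -- ### notation
  set d : ℕ := Φ.natDegree with hd
  set q : ℕ := Fintype.card K with hq
  set Z : Finset (K × K) := (Finset.univ.filter fun z ↦ Φ.evalEval z.1 z.2 = 0) with hZ
  -- nonsingular / singular zeros
  set Zns : Finset (K × K) := Z.filter fun z ↦
    (derivative Φ).evalEval z.1 z.2 ≠ 0 ∨ (derivative (Bivariate.swap Φ)).evalEval z.2 z.1 ≠ 0 with hZns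
  set Zs : Finset (K × K) := Z.filter fun z ↦
    ¬ ((derivative Φ).evalEval z.1 z.2 ≠ 0 ∨ (derivative (Bivariate.swap Φ)).evalEval z.2 z.1 ≠ 0) with hZs
  have hZcard : Zns.card + Zs.card = Z.card := Finset.card_filter_add_card_filter_not _
  set As : Finset K := Zs.image Prod.fst with hAs
  -- rational places, finite and infinite
  set S₁ : Finset (PlaceOver K (AdjoinRoot ΦL)) :=
    (finite_setOf_degree_eq (K := K) (F := AdjoinRoot ΦL) 1).toFinset with hS₁
  have hmemS₁ : ∀ P, P ∈ S₁ ↔ P.degree = 1 := fun P ↦ by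
    rw [hS₁, Set.Finite.mem_toFinset, Set.mem_setOf_eq]
  set T : Finset (PlaceOver K (AdjoinRoot ΦL)) := S₁.filter fun P ↦ x ∈ P.toValuationSubring with hT
  set Tinf : Finset (PlaceOver K (AdjoinRoot ΦL)) := S₁.filter fun P ↦ x ∉ P.toValuationSubring
    with hTinf
  have hS₁card : T.card + Tinf.card = S₁.card := Finset.card_filter_add_card_filter_not _
  have hmemT : ∀ P, P ∈ T ↔ P.degree = 1 ∧ x ∈ P.toValuationSubring := fun P ↦ by
    rw [hT, Finset.mem_filter, hmemS₁]
  have hyO : ∀ P : PlaceOver K (AdjoinRoot ΦL), x ∈ P.toValuationSubring →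
      pb.gen ∈ P.toValuationSubring := fun P hxP ↦ mem_of_mem_riemannRochSpace_negPart hx0 hy hxP
  -- ### centres of finite rational places
  let cx : PlaceOver K (AdjoinRoot ΦL) → K := fun P ↦
    if h : ∃ a : K, P.valuation (x - algebraMap K _ a) < 1 then Classical.choose h else 0
  let cy : PlaceOver K (AdjoinRoot ΦL) → K := fun P ↦
    if h : ∃ b : K, P.valuation (pb.gen - algebraMap K _ b) < 1 then Classical.choose h else 0
  have hcx : ∀ P ∈ T, P.valuation (x - algebraMap K _ (cx P)) < 1 := by
    intro P hP
    obtain ⟨h1, h2⟩ := (hmemT P).1 hP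
    have h : ∃ a : K, P.valuation (x - algebraMap K _ a) < 1 :=
      P.exists_valuation_sub_algebraMap_lt_one_of_degree_eq_one h1 h2
    simp only [cx, dif_pos h]
    exact Classical.choose_spec h
  have hcy : ∀ P ∈ T, P.valuation (pb.gen - algebraMap K _ (cy P)) < 1 := by
    intro P hP
    obtain ⟨h1, h2⟩ := (hmemT P).1 hP
    have h : ∃ b : K, P.valuation (pb.gen - algebraMap K _ b) < 1 :=
      P.exists_valuation_sub_algebraMap_lt_one_of_degree_eq_one h1 (hyO P h2)
    simp only [cy, dif_pos h]
    exact Classical.choose_spec h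
  have hcx_eq : ∀ (P : PlaceOver K (AdjoinRoot ΦL)) (a : K),
      P.valuation (x - algebraMap K _ a) < 1 → cx P = a := by
    intro P a ha
    have h : ∃ a : K, P.valuation (x - algebraMap K _ a) < 1 := ⟨a, ha⟩
    simp only [cx, dif_pos h]
    exact P.eq_of_valuation_sub_algebraMap_lt_one (Classical.choose_spec h) ha
  have hcy_eq : ∀ (P : PlaceOver K (AdjoinRoot ΦL)) (b : K),
      P.valuation (pb.gen - algebraMap K _ b) < 1 → cy P = b := by
    intro P b hb
    have h : ∃ b : K, P.valuation (pb.gen - algebraMap K _ b) < 1 := ⟨b, hb⟩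
    simp only [cy, dif_pos h]
    exact P.eq_of_valuation_sub_algebraMap_lt_one (Classical.choose_spec h) hb
  -- the centre is a zero of `Φ`
  have hcZ : ∀ P ∈ T, (cx P, cy P) ∈ Z := by
    intro P hP
    obtain ⟨h1, h2⟩ := (hmemT P).1 hP
    rw [hZ, Finset.mem_filter]
    refine ⟨Finset.mem_univ _, ?_⟩
    exact P.evalEval_eq_zero_of_residue_eq h2 (hyO P h2)
      ((P.residue_eq_algebraMap_iff h2 _).2 (hcx P hP))
      ((P.residue_eq_algebraMap_iff (hyO P h2) _).2 (hcy P hP)) hΦxy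
  -- ### nonsingular zeros correspond bijectively to the finite rational places above them
  have hbij : (T.filter fun P ↦ (cx P, cy P) ∈ Zns).card = Zns.card := by
    refine Finset.card_bij (fun P _ ↦ (cx P, cy P)) (fun P hP ↦ (Finset.mem_filter.1 hP).2)
      (fun P₁ hP₁ P₂ hP₂ heq ↦ ?_) (fun z hz ↦ ?_)
    · -- injectivity: both places are centred at the same nonsingular zero
      obtain ⟨hP₁T, hz⟩ := Finset.mem_filter.1 hP₁
      obtain ⟨hP₂T, -⟩ := Finset.mem_filter.1 hP₂
      obtain ⟨hzZ, hns⟩ := Finset.mem_filter.1 hz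
      have hab : Φ.evalEval (cx P₁) (cy P₁) = 0 := (Finset.mem_filter.1 hzZ).2
      obtain ⟨P₀, -, -, -, -, -, huniq⟩ := exists_place_of_nonsingular hm pb hmin hab hns
      have h1 : P₁ = P₀ := huniq P₁ ((hmemT P₁).1 hP₁T).2 (hyO _ ((hmemT P₁).1 hP₁T).2)
        (hcx P₁ hP₁T) (hcy P₁ hP₁T)
      have heq' : cx P₂ = cx P₁ ∧ cy P₂ = cy P₁ := by
        simpa [Prod.mk.injEq] using heq.symm
      have h2 : P₂ = P₀ := huniq P₂ ((hmemT P₂).1 hP₂T).2 (hyO _ ((hmemT P₂).1 hP₂T).2)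
        (heq'.1 ▸ hcx P₂ hP₂T) (heq'.2 ▸ hcy P₂ hP₂T)
      rw [h1, h2]
    · -- surjectivity: the place above a nonsingular zero
      obtain ⟨hzZ, hns⟩ := Finset.mem_filter.1 hz
      have hab : Φ.evalEval z.1 z.2 = 0 := (Finset.mem_filter.1 hzZ).2
      obtain ⟨P₀, hdeg1, hxP, -, hvx, hvy, -⟩ := exists_place_of_nonsingular hm pb hmin hab hns
      have hP₀T : P₀ ∈ T := (hmemT P₀).2 ⟨hdeg1, hxP⟩
      have hc : (cx P₀, cy P₀) = z := Prod.ext (hcx_eq P₀ _ hvx) (hcy_eq P₀ _ hvy)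
      exact ⟨P₀, Finset.mem_filter.2 ⟨hP₀T, hc ▸ hz⟩, hc⟩
  -- ### at most `d` finite rational places have centre with first coordinate `a`
  have hfib : ∀ a : K, (T.filter fun P ↦ cx P = a).card ≤ d := by
    intro a
    rw [← hfin]
    refine card_le_finrank_of_forall_ord_sub_pos hxt a _ fun P hP ↦ ?_
    obtain ⟨hPT, hPa⟩ := Finset.mem_filter.1 hP
    have hv := hcx P hPT
    rw [hPa] at hv
    exact (P.valuation_lt_one_iff_ord_pos (sub_ne_zero.2 (algebraMap_X_ne_algebraMap a))).1 hv
  -- ### finite rational places centred at singular zeros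
  have hTs : (T.filter fun P ↦ (cx P, cy P) ∉ Zns).card ≤ As.card * d := by
    have hsub : (T.filter fun P ↦ (cx P, cy P) ∉ Zns) ⊆ As.biUnion fun a ↦ T.filter fun P ↦ cx P = a := by
      intro P hP
      obtain ⟨hPT, hPns⟩ := Finset.mem_filter.1 hP
      have hPs : (cx P, cy P) ∈ Zs := by
        rw [hZs, Finset.mem_filter]
        refine ⟨hcZ P hPT, fun hns ↦ hPns ?_⟩
        rw [hZns, Finset.mem_filter]
        exact ⟨hcZ P hPT, hns⟩
      rw [Finset.mem_biUnion]
      exact ⟨cx P, Finset.mem_image.2 ⟨_, hPs, rfl⟩, Finset.mem_filter.2 ⟨hPT, rfl⟩⟩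
    calc _ ≤ (As.biUnion fun a ↦ T.filter fun P ↦ cx P = a).card := Finset.card_le_card hsub
      _ ≤ ∑ a ∈ As, (T.filter fun P ↦ cx P = a).card := Finset.card_biUnion_le
      _ ≤ ∑ _a ∈ As, d := Finset.sum_le_sum fun a _ ↦ hfib a
      _ = As.card * d := by rw [Finset.sum_const, smul_eq_mul]
  -- ### singular zeros: at most `d` above each `a ∈ As`
  have hZs_le : Zs.card ≤ As.card * d := by
    have hsub : Zs ⊆ As.biUnion fun a ↦ Z.filter fun z ↦ z.1 = a := by
      intro z hz
      rw [Finset.mem_biUnion]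
      exact ⟨z.1, Finset.mem_image.2 ⟨z, hz, rfl⟩,
        Finset.mem_filter.2 ⟨(Finset.mem_filter.1 hz).1, rfl⟩⟩
    have hfibZ : ∀ a : K, (Z.filter fun z ↦ z.1 = a).card ≤ d := by
      intro a
      calc (Z.filter fun z ↦ z.1 = a).card
          ≤ ((Finset.univ : Finset K).filter fun b ↦ Φ.evalEval a b = 0).card := by
            refine Finset.card_le_card_of_injOn Prod.snd (fun z hz ↦ ?_) ?_
            · obtain ⟨hzZ, hza⟩ := Finset.mem_filter.1 hz
              rw [Finset.coe_filter, Set.mem_setOf_eq]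
              refine ⟨Finset.mem_univ _, ?_⟩
              rw [← hza]
              exact (Finset.mem_filter.1 hzZ).2
            · intro z₁ hz₁ z₂ hz₂ h
              obtain ⟨-, h₁⟩ := Finset.mem_filter.1 (Finset.mem_coe.1 hz₁)
              obtain ⟨-, h₂⟩ := Finset.mem_filter.1 (Finset.mem_coe.1 hz₂)
              exact Prod.ext (h₁.trans h₂.symm) h
        _ ≤ d := card_filter_evalEval_le hm a
    calc _ ≤ (As.biUnion fun a ↦ Z.filter fun z ↦ z.1 = a).card := Finset.card_le_card hsub
      _ ≤ ∑ a ∈ As, (Z.filter fun z ↦ z.1 = a).card := Finset.card_biUnion_le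
      _ ≤ ∑ _a ∈ As, d := Finset.sum_le_sum fun a _ ↦ hfibZ a
      _ = As.card * d := by rw [Finset.sum_const, smul_eq_mul]
  -- ### `As` lies among the roots of the eliminant
  have hAs_le : As.card ≤ 4 * d ^ 2 := by
    obtain ⟨R, hR0, hRd, hR⟩ := exists_eliminant_singular hm hirrK hdeg
    have hsub : As ⊆ R.roots.toFinset := by
      intro a ha
      obtain ⟨z, hz, rfl⟩ := Finset.mem_image.1 ha
      obtain ⟨hzZ, hzs⟩ := Finset.mem_filter.1 hz
      rw [not_or, not_ne_iff, not_ne_iff] at hzs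
      rw [Multiset.mem_toFinset, mem_roots hR0, IsRoot.def]
      exact hR z.1 z.2 (Finset.mem_filter.1 hzZ).2 hzs.1 hzs.2
    calc As.card ≤ R.roots.toFinset.card := Finset.card_le_card hsub
      _ ≤ R.roots.card := Multiset.toFinset_card_le _
      _ ≤ R.natDegree := card_roots' _
      _ ≤ 4 * d ^ 2 := hRd
  -- ### places at infinity
  have hTinf : Tinf.card ≤ d := by
    rw [← hfin]
    exact card_le_finrank_of_forall_not_mem hxt Tinf fun P hP ↦ (Finset.mem_filter.1 hP).2
  -- ### the count in `ℕ`
  have hTsplit : (T.filter fun P ↦ (cx P, cy P) ∈ Zns).card +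
      (T.filter fun P ↦ (cx P, cy P) ∉ Zns).card = T.card :=
    Finset.card_filter_add_card_filter_not _
  have hAd : As.card * d ≤ 4 * d ^ 3 := by
    calc As.card * d ≤ 4 * d ^ 2 * d := Nat.mul_le_mul_right _ hAs_le
      _ = 4 * d ^ 3 := by ring
  have hupper : Z.card ≤ S₁.card + 4 * d ^ 3 := by
    have h1 : Zns.card ≤ T.card := by rw [← hbij]; exact Finset.card_filter_le _ _
    omega
  have hlower : S₁.card ≤ Z.card + d + 4 * d ^ 3 := by
    have h1 : T.card ≤ Zns.card + As.card * d := by rw [← hbij]; omega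
    omega
  -- ### the Hasse–Weil bounds for `#S₁` and the genus bound
  have hHW := card_toFinset_degree_eq_one_mem_Icc (K := K) (F := AdjoinRoot ΦL)
  rw [← hS₁] at hHW
  obtain ⟨hHW1, hHW2⟩ := hHW
  have hg : (2 * genus K (AdjoinRoot ΦL) : ℝ) ≤ ((d - 1) * (d - 2) : ℕ) := by exact_mod_cast hgenus
  have hs : 0 ≤ √(q : ℝ) := Real.sqrt_nonneg _
  have hgs := mul_le_mul_of_nonneg_right hg hs
  have hupper' : (Z.card : ℝ) ≤ S₁.card + 4 * (d : ℝ) ^ 3 := by exact_mod_cast hupper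
  have hlower' : (S₁.card : ℝ) ≤ Z.card + d + 4 * (d : ℝ) ^ 3 := by exact_mod_cast hlower
  rw [← hq] at hHW1 hHW2
  push_cast at hg hgs hHW1 hHW2 ⊢
  constructor
  · linarith
  · linarith

end Literature.NumberTheory.DiophantineGeometry.AlgFunctionField

end
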